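import Literature.NumberTheory.QuadraticFields.ThreeTorsionMean
import Mathlib.NumberTheory.DirichletCharacter.Basic
import HarnessLib

/-!
# Taniguchi–Thorne at the prime `2`: `#Cl₃` under a local specification at `2`, and twists by Dirichlet characters of `2`-power modulus (named fact)

Companion of `ThreeTorsionMean.lean` (Davenport–Heilbronn / Bhargava–Taniguchi–Thorne /
Taniguchi–Thorne named facts on `t(D) = #Cl(ℚ(√D))[3] = quadFieldThreeTorsion D` summed over
fundamental discriminants `negFundDiscrs X`, `posFundDiscrs X`). That file vendors Taniguchi–Thorne's
Theorem 6 (progressions `a (mod m)` with `(6a, m) = 1`) and records that the `2`-power moduli needed for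
binary digits are reached in print only through the paper's general twisted theorem. This file vendors
exactly the two printed inputs AT THE PRIME `2`, as the named fact `tt_threeTorsion_twoAdic`:

* **(i) Theorem 4 of the paper with a local specification at `2`** ("we may restrict our sum to `D` for
  which finitely many primes `p` are inert, split, or ramified. In the ramified case we may also specify
  the completion of `ℚ(√D)` at `p`"; "a specification at `2` is determined by `D (mod 64)`", §6.3):
  `Σ'_{0<±D<X} #Cl₃(D) = ((3 + C^±)/π²) C'(𝒮) X + K'^±(𝒮) (…) X^{5/6} + O(X^{18/23+ε} ∏ p^{20e_p/23})`,
  `C⁻ = 3`, `C⁺ = 1`. The eight completions `ℚ(√D) ⊗ ℚ₂` are the residue classes `D ≡ r s (mod 8r)`,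
  `r = 2^{v₂(D)} ∈ {1, 4, 8}`, `s` odd `mod 8`, with `e(rs, 2) = 1` (`ttLocalFactorTwo`, the local
  factor at `2` of Lemma 21, `ThreeTorsionMean.lean`), and `C'(𝒮)` is the normalised local density of
  §6.2–6.3: the cubic types over a quadratic type have unnormalised densities `1/6 + 1/3` (split:
  totally split or inert cubic), `1/2` (inert: partially split cubic), `(1/p)·(1/4) = 1/8` (each of the two
  ramified `ℤ₂`-algebras `x² + 2x ± 2`, conductor `2³`, i.e. `ℚ₂(√-1)`, `ℚ₂(√3)`: `D ≡ 28, 12 (mod 32)`),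
  `(1/p)·(1/8) = 1/16` (each of `x² ± 2u`, `u = 1, 3`, conductor `2⁴`: `D ≡ 8, 24, 40, 56 (mod 64)`),
  normalised by dividing by `C₂ = 1 + 1/2` (§6.3, "adding the unnormalized densities for all splitting
  types other than totally ramified"). Hence `C'(𝒮) = 1/3, 1/3, 1/12, 1/12, 1/24, 1/24, 1/24, 1/24`, which
  is `1/(3r)` in every case, and the main terms are `(6/π²)/(3r) · X = 2/(r π²) · X` (`D < 0`) and
  `(4/π²)/(3r) · X = 4/(3 r π²) · X` (`D > 0`). Rendered, as the other facts of `ThreeTorsionMean.lean`,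
  with the secondary coefficient EXISTENTIAL and the error `O_{ε}(X^{18/23+ε})` per type (weaker than
  print). Consistency: over the eight types the main constants add up to `6/π²` and `4/π²`
  (`btt_threeTorsion_sum`), and against Lemma 21 (`tt_count_quadraticFields_progression`, PROVED:
  each of the `24` admissible classes `mod 64` holds `X/(8π²) + O(√X)` discriminants of either sign, so a
  type `(r, s)` holds `X/(r π²) + O(√X)`) the means are `2` and `4/3` on every type — the paper's footnote
  to §6.3: "the local densities of trivial and nontrivial 3-torsion elements of the class group are the
  same at all finite places".
* **(ii) Theorem 25 of the paper for characters of `2`-power modulus with `χ⁶ ≠ 1`**: with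
  `M₃^±(X, 𝒮; r, χ) := Σ'_{0<±Disc(K)≤X, K ∈ 𝒮} χ(Disc(K)/r)`, the sum over the nowhere totally ramified
  cubic fields `K` with the local specification `𝒮` ("Recall that these are in bijection with pairs of
  nontrivial 3-torsion elements in `Cl(ℚ(√Disc(K)))`", §6.6 — so the number of such `K` of discriminant
  `D` is `(#Cl₃(D) - 1)/2`), "Whenever `χ⁶ ≠ 1`, we have `M₃^±(X, 𝒮; r, χ) = O(X^{18/23+ε} N^{20/23})`".
  Here `𝒮` is the local specification at `2` given by a type `(r, s)` (for the split type the two cubic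
  types above it, summed — the paper's convention that `𝒮₂` is a single cubic `ℤ₂`-algebra, §6.4),
  `r = 2^{v₂(Disc)}` as the paper's `r` (§6.4: "`r_p` the `p`-adic valuations of the discriminants of the
  cubic rings specified by `𝒮_p`", so that `Disc(K)/r` is odd), `χ` any Dirichlet character `mod 2ᵏ`
  with `χ⁶ ≠ 1` (imprimitive characters are induced from primitive ones of smaller `2`-power modulus and
  agree with them on odd residues; §6.4: "We may handle imprimitive characters by introducing local
  specifications"), the weight is `χ(D/r) · (#Cl₃(D) - 1)/2` summed over fundamental `D` of the type with
  `|D| < X` (`X ∈ ℕ`, so `≤ X - 1`), and the implied constant is per `(r, s, k, χ, ε)` (weaker than print).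

What is NOT here: the secondary terms for `χ⁶ = 1`, `χ ≠ 1` (for `2`-power modulus these are the
quadratic characters of conductor `4` and `8`, constant on each type: §6.5, "There are no primitive
quadratic characters to moduli which are higher powers of `2`, so fields equidistribute in
subprogressions modulo `16` and above"; "For `p = 2`, there are no cubic characters, and cubic fields
equidistribute in subprogressions of the arithmetic progression corresponding to each local
specification at `2`"), the odd primes, and the deduction of means in classes `a (mod 2ᵏ)`
(orthogonality of characters `mod 2ᵏ/r` on `D/r`; left to consumers, e.g. route
QuantumAdvantage/ArithStatLadder's `EndJuntaRung`).

## References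

* T. Taniguchi, F. Thorne, *Secondary terms in counting functions for cubic fields*, Duke Math. J.
  162 (2013) 2451–2508 = arXiv:1102.2914: Thm 4 (p. 3), §6.2 (density tables, incl. the `p = 2` table of
  ramified quadratic `ℤ₂`-algebras), §6.3 (local specifications for `ℚ(√D)`: "`D (mod 64)`";
  normalisation `C_p = 1 + p⁻¹`; footnote on the trivial class), §6.4 (conventions on `𝒮`, `r`, `χ`, `N`),
  Thm 25 and §6.6 (pp. 27–28) [TaniguchiThorne2013].

## Mathlib search

`DirichletCharacter`, `MulChar` (group structure: `χ ^ 6`), `Int.ModEq`, `negFundDiscrs`,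
`posFundDiscrs`, `quadFieldThreeTorsion` (tree).
-/

noncomputable section

open Finset

namespace Literature.NumberTheory.QuadraticFields

/-- **Taniguchi–Thorne 2013 (Duke) at the prime `2`** (both signs). The eight completions
`ℚ(√D) ⊗ ℚ₂` of a quadratic field are the classes `D ≡ r s (mod 8r)` of its discriminant with
`r ∈ {1, 4, 8}` (`r = 2^{v₂(D)}`), `s ∈ {1, 3, 5, 7}` and `e(rs, 2) = 1` (`ttLocalFactorTwo`, the
local factor of Lemma 21: `rs ≡ 1 (mod 4)` or `rs ≡ 8, 12 (mod 16)`), namely split `D ≡ 1 (8)`,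
inert `D ≡ 5 (8)`, ramified `ℚ₂(√3), ℚ₂(√-1)`: `D ≡ 12, 28 (mod 32)` (`D = 4m`, `m ≡ 3, 7 (8)`),
ramified `ℚ₂(√2), ℚ₂(√6), ℚ₂(√-6), ℚ₂(√-2)`: `D ≡ 8, 24, 40, 56 (mod 64)` (`D = 8m'`,
`m' ≡ 1, 3, 5, 7 (8)`) — Taniguchi–Thorne §6.3: "a specification at `2` is determined by
`D (mod 64)`". (i) **Theorem 4 with a local specification at `2`**: for each such `(r, s)` there
are `K⁻, K⁺ ∈ ℝ` with, for every `ε > 0`,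
`Σ_{-X<D<0, D ≡ rs (8r)} #Cl₃(D) = (2/(r π²)) X + K⁻ X^{5/6} + O_ε(X^{18/23+ε})` and
`Σ_{0<D<X, D ≡ rs (8r)} #Cl₃(D) = (4/(3 r π²)) X + K⁺ X^{5/6} + O_ε(X^{18/23+ε})`
(printed main term `((3 + C^±)/π²) C'(𝒮) X`, `C⁻ = 3`, `C⁺ = 1`, with the normalised `2`-adic
density `C'(𝒮) = 1/(3r)` from the tables of §6.2–6.3; secondary coefficient existential, error
per type — weaker than print). (ii) **Theorem 25 for `χ (mod 2ᵏ)` with `χ⁶ ≠ 1`**: for each such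
`(r, s)`, each `k` and each Dirichlet character `χ` modulo `2ᵏ` with `χ⁶ ≠ 1`, for every `ε > 0`,
`Σ_{0<∓D<X, D ≡ rs (8r)} χ(D/r) · (#Cl₃(D) - 1)/2 = O_{r,s,k,χ,ε}(X^{18/23+ε})` — the printed
`M₃^±(X, 𝒮; r, χ) = O(X^{18/23+ε} N^{20/23})`, `M₃^±` the `χ(Disc/r)`-twisted number of nowhere
totally ramified cubic fields with the local specification `𝒮` at `2`, i.e. (Hasse) of pairs of
nontrivial `3`-torsion ideal classes of `ℚ(√D)`, `D` of type `(r, s)`. Here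
`#Cl₃(D) = quadFieldThreeTorsion D` and `D` runs over `negFundDiscrs X` / `posFundDiscrs X`.
[cite: TaniguchiThorne2013, Theorem 4 (with §6.3) and Theorem 25] -/
def tt_threeTorsion_twoAdic : Prop :=
  ∀ r ∈ ({1, 4, 8} : Finset ℕ), ∀ s ∈ ({1, 3, 5, 7} : Finset ℤ), ttLocalFactorTwo (r * s) = 1 →
    ((∃ K : ℝ, ∀ ε : ℝ, 0 < ε → ∃ C : ℝ, ∀ X : ℕ, 1 ≤ X →
      |(∑ D ∈ (negFundDiscrs X).filter (fun D => D ≡ r * s [ZMOD ((8 * r : ℕ) : ℤ)]),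
          (quadFieldThreeTorsion D : ℝ)) - 2 / (r * Real.pi ^ 2) * X
          - K * (X : ℝ) ^ ((5 : ℝ) / 6)| ≤ C * (X : ℝ) ^ ((18 : ℝ) / 23 + ε)) ∧
    (∃ K : ℝ, ∀ ε : ℝ, 0 < ε → ∃ C : ℝ, ∀ X : ℕ, 1 ≤ X →
      |(∑ D ∈ (posFundDiscrs X).filter (fun D => D ≡ r * s [ZMOD ((8 * r : ℕ) : ℤ)]),
          (quadFieldThreeTorsion D : ℝ)) - 4 / (3 * r * Real.pi ^ 2) * X
          - K * (X : ℝ) ^ ((5 : ℝ) / 6)| ≤ C * (X : ℝ) ^ ((18 : ℝ) / 23 + ε))) ∧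
    (∀ (k : ℕ) (χ : DirichletCharacter ℂ (2 ^ k)), χ ^ 6 ≠ 1 →
      (∀ ε : ℝ, 0 < ε → ∃ C : ℝ, ∀ X : ℕ, 1 ≤ X →
        ‖∑ D ∈ (negFundDiscrs X).filter (fun D => D ≡ r * s [ZMOD ((8 * r : ℕ) : ℤ)]),
            χ (((D / (r : ℤ) : ℤ)) : ZMod (2 ^ k)) * (((quadFieldThreeTorsion D : ℂ) - 1) / 2)‖
          ≤ C * (X : ℝ) ^ ((18 : ℝ) / 23 + ε)) ∧
      (∀ ε : ℝ, 0 < ε → ∃ C : ℝ, ∀ X : ℕ, 1 ≤ X →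
        ‖∑ D ∈ (posFundDiscrs X).filter (fun D => D ≡ r * s [ZMOD ((8 * r : ℕ) : ℤ)]),
            χ (((D / (r : ℤ) : ℤ)) : ZMod (2 ^ k)) * (((quadFieldThreeTorsion D : ℂ) - 1) / 2)‖
          ≤ C * (X : ℝ) ^ ((18 : ℝ) / 23 + ε)))

/-! ### Projections -/

/-- The imaginary half of (i) at a type `(r, s)`:
`Σ_{-X<D<0, D ≡ rs (8r)} #Cl₃(D) = (2/(r π²)) X + K X^{5/6} + O_ε(X^{18/23+ε})`.
[cite: TaniguchiThorne2013, Theorem 4 (with §6.3)] -/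
theorem tt_threeTorsion_twoAdic.sum_neg (h : tt_threeTorsion_twoAdic) {r : ℕ} {s : ℤ}
    (hr : r ∈ ({1, 4, 8} : Finset ℕ)) (hs : s ∈ ({1, 3, 5, 7} : Finset ℤ))
    (he : ttLocalFactorTwo (r * s) = 1) :
    ∃ K : ℝ, ∀ ε : ℝ, 0 < ε → ∃ C : ℝ, ∀ X : ℕ, 1 ≤ X →
      |(∑ D ∈ (negFundDiscrs X).filter (fun D => D ≡ r * s [ZMOD ((8 * r : ℕ) : ℤ)]),
          (quadFieldThreeTorsion D : ℝ)) - 2 / (r * Real.pi ^ 2) * X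
          - K * (X : ℝ) ^ ((5 : ℝ) / 6)| ≤ C * (X : ℝ) ^ ((18 : ℝ) / 23 + ε) :=
  (h r hr s hs he).1.1

/-- The real half of (i) at a type `(r, s)`:
`Σ_{0<D<X, D ≡ rs (8r)} #Cl₃(D) = (4/(3 r π²)) X + K X^{5/6} + O_ε(X^{18/23+ε})`.
[cite: TaniguchiThorne2013, Theorem 4 (with §6.3)] -/
theorem tt_threeTorsion_twoAdic.sum_pos (h : tt_threeTorsion_twoAdic) {r : ℕ} {s : ℤ}
    (hr : r ∈ ({1, 4, 8} : Finset ℕ)) (hs : s ∈ ({1, 3, 5, 7} : Finset ℤ))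
    (he : ttLocalFactorTwo (r * s) = 1) :
    ∃ K : ℝ, ∀ ε : ℝ, 0 < ε → ∃ C : ℝ, ∀ X : ℕ, 1 ≤ X →
      |(∑ D ∈ (posFundDiscrs X).filter (fun D => D ≡ r * s [ZMOD ((8 * r : ℕ) : ℤ)]),
          (quadFieldThreeTorsion D : ℝ)) - 4 / (3 * r * Real.pi ^ 2) * X
          - K * (X : ℝ) ^ ((5 : ℝ) / 6)| ≤ C * (X : ℝ) ^ ((18 : ℝ) / 23 + ε) :=
  (h r hr s hs he).1.2

/-- The imaginary half of (ii) at a type `(r, s)`, modulus `2ᵏ`, character `χ` with `χ⁶ ≠ 1`: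
`‖Σ_{-X<D<0, D ≡ rs (8r)} χ(D/r) (#Cl₃(D) - 1)/2‖ = O_ε(X^{18/23+ε})`.
[cite: TaniguchiThorne2013, Theorem 25] -/
theorem tt_threeTorsion_twoAdic.twist_neg (h : tt_threeTorsion_twoAdic) {r : ℕ} {s : ℤ}
    (hr : r ∈ ({1, 4, 8} : Finset ℕ)) (hs : s ∈ ({1, 3, 5, 7} : Finset ℤ))
    (he : ttLocalFactorTwo (r * s) = 1) {k : ℕ} {χ : DirichletCharacter ℂ (2 ^ k)}
    (hχ : χ ^ 6 ≠ 1) {ε : ℝ} (hε : 0 < ε) :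
    ∃ C : ℝ, ∀ X : ℕ, 1 ≤ X →
      ‖∑ D ∈ (negFundDiscrs X).filter (fun D => D ≡ r * s [ZMOD ((8 * r : ℕ) : ℤ)]),
          χ (((D / (r : ℤ) : ℤ)) : ZMod (2 ^ k)) * (((quadFieldThreeTorsion D : ℂ) - 1) / 2)‖
        ≤ C * (X : ℝ) ^ ((18 : ℝ) / 23 + ε) :=
  ((h r hr s hs he).2 k χ hχ).1 ε hε

/-- The real half of (ii) at a type `(r, s)`, modulus `2ᵏ`, character `χ` with `χ⁶ ≠ 1`:
`‖Σ_{0<D<X, D ≡ rs (8r)} χ(D/r) (#Cl₃(D) - 1)/2‖ = O_ε(X^{18/23+ε})`.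
[cite: TaniguchiThorne2013, Theorem 25] -/
theorem tt_threeTorsion_twoAdic.twist_pos (h : tt_threeTorsion_twoAdic) {r : ℕ} {s : ℤ}
    (hr : r ∈ ({1, 4, 8} : Finset ℕ)) (hs : s ∈ ({1, 3, 5, 7} : Finset ℤ))
    (he : ttLocalFactorTwo (r * s) = 1) {k : ℕ} {χ : DirichletCharacter ℂ (2 ^ k)}
    (hχ : χ ^ 6 ≠ 1) {ε : ℝ} (hε : 0 < ε) :
    ∃ C : ℝ, ∀ X : ℕ, 1 ≤ X →
      ‖∑ D ∈ (posFundDiscrs X).filter (fun D => D ≡ r * s [ZMOD ((8 * r : ℕ) : ℤ)]),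
          χ (((D / (r : ℤ) : ℤ)) : ZMod (2 ^ k)) * (((quadFieldThreeTorsion D : ℂ) - 1) / 2)‖
        ≤ C * (X : ℝ) ^ ((18 : ℝ) / 23 + ε) :=
  ((h r hr s hs he).2 k χ hχ).2 ε hε

/-! ### Sanity lemmas: the eight types -/

/-- The admissible pairs `(r, s)`: exactly the eight `2`-adic types `(1,1), (1,5), (4,3), (4,7),
(8,1), (8,3), (8,5), (8,7)` (classes `1, 5 (mod 8)`, `12, 28 (mod 32)`, `8, 24, 40, 56 (mod 64)`).
[folklore] -/
theorem ttLocalFactorTwo_mul_eq_one_iff {r : ℕ} {s : ℤ} (hr : r ∈ ({1, 4, 8} : Finset ℕ))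
    (hs : s ∈ ({1, 3, 5, 7} : Finset ℤ)) :
    ttLocalFactorTwo (r * s) = 1 ↔
      (r = 1 ∧ (s = 1 ∨ s = 5)) ∨ (r = 4 ∧ (s = 3 ∨ s = 7)) ∨ r = 8 := by
  simp only [Finset.mem_insert, Finset.mem_singleton] at hr hs
  rcases hr with rfl | rfl | rfl <;> rcases hs with rfl | rfl | rfl | rfl <;>
    norm_num [ttLocalFactorTwo]

/-- Over the eight types the imaginary main constants `2/(r π²)` add up to `6/π²`, the main
constant of `btt_threeTorsion_sum` (`2 + 2 + 1/2 + 1/2 + 4 · 1/4 = 6`), and the real ones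
`4/(3 r π²)` to `4/π²`. [folklore] -/
example : (2 / (1 * Real.pi ^ 2) + 2 / (1 * Real.pi ^ 2)) + (2 / (4 * Real.pi ^ 2) + 2 / (4 * Real.pi ^ 2))
    + 4 * (2 / (8 * Real.pi ^ 2)) = 6 / Real.pi ^ 2 ∧
    (4 / (3 * 1 * Real.pi ^ 2) + 4 / (3 * 1 * Real.pi ^ 2)) +
      (4 / (3 * 4 * Real.pi ^ 2) + 4 / (3 * 4 * Real.pi ^ 2)) + 4 * (4 / (3 * 8 * Real.pi ^ 2))
      = 4 / Real.pi ^ 2 := by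
  have hπ : Real.pi ^ 2 ≠ 0 := by positivity
  constructor <;> field_simp <;> ring

end Literature.NumberTheory.QuadraticFields

end
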